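import Summits.ResolutionOfSingularities.ResolutionOfSingularities.Theorems.VeryNearCutClasses
import HarnessLib

/-!
# VeryNearCutKernels — pure-logic kernels of the node «VeryNearCut» (exact cuts, the engine at work, comparison with N50)
(decomp-res node N53, lens-2 g10, source sha256 323417289ddca7f6; CRITIC-LEDGER row 66 CLEARED; route-independent part,
phase 1b of 3 — vocabulary in `Theorems/VeryNearCutClasses`, route-facing kernels in `Theorems/MaxContactCutVeryNearCut`)

Kernels (0 sorry, all BY NAME over `VeryNearCutClasses` and the tree's `FaceFormCutClasses` / `WeakOrderReduction`):
* EXACT at each marking: `SeqDimFour 1 n ⟺ SeqNGen n ∧ SeqNSpec n` (`seqDimFour_one_iff`, excluded middle on «some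
  near-special top point»); EXACT three-way sub-cut of the located class `SeqNSpec n ⟺ SeqNSpecDeep n ∧ SeqNSpecPower n ∧
  SeqNSpecFin n` (`seqNSpec_iff`, nested excluded middle); by-letter weakenings; `E 1 ⟺` the two families
  (`e_one_iff_families`); `NearSpecialRung ⟺` its three strata at the rung (`nearSpecialRung_iff_strata`).
* THE ENGINE AT WORK: `VeryNearExit` + `OneShotPortTwo n` ⇒ `NGenRungAt n` (`n ≥ 2`), `OrderOneContact` ⇒ `NGenRungAt 1`,
  hence `nearGenericRung_of_engine : VeryNearExit → (∀ n ≥ 2, OneShotPortTwo n) → OrderOneContact → NearGenericRung`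
  — the near-generic half is DECIDED modulo the typed engine (port L, prover target #19) and two COSTUME ports.
* COMPARISON WITH N50 (tree `FaceFormCutClasses`, pointwise and graded, pure logic): a g9 generic face is near-generic
  with the EMPTY list (`hasNearGenericFace_of_hasGenericFace`, threshold `max(2,n−1) ≤ max(2,n)`), so
  `IsFaceGenericPt ⇒ IsNearGenericPt`, `IsNearSpecialPt ⇒ IsFaceSpecialPt`, `SeqNGen n ⇒ SeqGen n` (the g10 decided
  piece is STRONGER) and `SeqSpec n ⇒ SeqNSpec n` (the g10 located residual is WEAKER BY LETTER).  The edges to the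
  route asides 31576/31577/31578 and to 29273/28544/30461 are in `Theorems/MaxContactCutVeryNearCut`.
(Sources: CossartPiltant2008 proof of Prop. 4.2 (a)(b), Lemma 4.3; Hironaka1970 Thm 2, 3; CossartJannsenSaito2020 §2, Thm
9.3/9.6; BierstoneGrigorievMilmanWlodarczyk2011 §3.1.)
-/

open CategoryTheory AlgebraicGeometry TopologicalSpace IsLocalRing
open Literature.AlgebraicGeometry.Resolution
open Summit.ResolutionOfSingularities.ResolutionOfSingularities.Theorems
open Summit.ResolutionOfSingularities.ResolutionOfSingularities.Theorems.WeakOrderReduction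
open Summit.ResolutionOfSingularities.ResolutionOfSingularities.Theorems.VeryNearCutClasses

namespace Summit.ResolutionOfSingularities.ResolutionOfSingularities.Theorems.VeryNearCutKernels

/-! ## §5  Kernels — pure logic (0 sorry) -/

section Kernels

variable {n : ℕ}

/-- Pointwise trichotomy → dichotomy. [folklore] -/
theorem classGE_or_nearGeneric_or_special {k : Type} [Field k] {Y : Scheme.{0}} (g : Y ⟶ Spec (.of k))
    (hY : Scheme.IsRegular Y) (I : Y.IdealSheafData) (n : ℕ) (y : Y) :
    (ClassGE g hY I n 2 y ∨ IsNearGenericPt I n y) ∨ IsNearSpecialPt g hY I n y := by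
  by_cases h1 : ClassGE g hY I n 2 y
  · exact Or.inl (Or.inl h1)
  by_cases h2 : IsNearGenericPt I n y
  · exact Or.inl (Or.inr h2)
  · exact Or.inr ⟨h1, h2⟩

/-- **EXACT at each marking**: `SeqDimFour 1 n ⟺ SeqNGen n ∧ SeqNSpec n`. [folklore] -/
theorem seqDimFour_one_iff : SeqDimFour 1 n ↔ SeqNGen n ∧ SeqNSpec n := by
  constructor
  · intro h
    refine ⟨?_, ?_⟩
    · intro p hp k _ _ Y g h1 h2 h3 hY h4 I hord _
      exact h p hp k Y g h1 h2 h3 hY h4 I hord (fun y _ => Or.inl le_rfl)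
    · intro p hp k _ _ Y g h1 h2 h3 hY h4 I hord _
      exact h p hp k Y g h1 h2 h3 hY h4 I hord (fun y _ => Or.inl le_rfl)
  · rintro ⟨hG, hS⟩ p hp k _ _ Y g h1 h2 h3 hY h4 I hord _
    by_cases hex : ∃ y : Y, idealOrder I y = ((n : ℕ) : ℕ∞) ∧ IsNearSpecialPt g hY I n y
    · exact hS p hp k Y g h1 h2 h3 hY h4 I hord hex
    · refine hG p hp k Y g h1 h2 h3 hY h4 I hord ?_
      intro y hy
      rcases classGE_or_nearGeneric_or_special g hY I n y with h | h
      · exact h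
      · exact absurd ⟨y, hy, h⟩ hex

/-- **EXACT three-way sub-cut of the located class**: `SeqNSpec n ⟺ Deep ∧ Power ∧ Fin` (nested excluded middle on
«some near-special top point is deep», then «some near-special top point has a power face»). [folklore] -/
theorem seqNSpec_iff : SeqNSpec n ↔ SeqNSpecDeep n ∧ SeqNSpecPower n ∧ SeqNSpecFin n := by
  constructor
  · intro h
    refine ⟨?_, ?_, ?_⟩
    · intro p hp k _ _ Y g h1 h2 h3 hY h4 I hord hex
      obtain ⟨y, hy, hs, -⟩ := hex
      exact h p hp k Y g h1 h2 h3 hY h4 I hord ⟨y, hy, hs⟩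
    · intro p hp k _ _ Y g h1 h2 h3 hY h4 I hord _ hex
      obtain ⟨y, hy, hs, -⟩ := hex
      exact h p hp k Y g h1 h2 h3 hY h4 I hord ⟨y, hy, hs⟩
    · intro p hp k _ _ Y g h1 h2 h3 hY h4 I hord hex _
      exact h p hp k Y g h1 h2 h3 hY h4 I hord hex
  · rintro ⟨hD, hP, hF⟩ p hp k _ _ Y g h1 h2 h3 hY h4 I hord hex
    by_cases hdeep :
        ∃ y : Y, idealOrder I y = ((n : ℕ) : ℕ∞) ∧ IsNearSpecialPt g hY I n y ∧ FaceFormCutClasses.IsDeepFacePt I n y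
    · exact hD p hp k Y g h1 h2 h3 hY h4 I hord hdeep
    have hnd : ∀ y : Y, idealOrder I y = ((n : ℕ) : ℕ∞) → IsNearSpecialPt g hY I n y →
        ¬ FaceFormCutClasses.IsDeepFacePt I n y :=
      fun y hy hs hd => hdeep ⟨y, hy, hs, hd⟩
    by_cases hpow : ∃ y : Y, idealOrder I y = ((n : ℕ) : ℕ∞) ∧ IsNearSpecialPt g hY I n y ∧ IsPowerFacePt I n y
    · exact hP p hp k Y g h1 h2 h3 hY h4 I hord hnd hpow
    · refine hF p hp k Y g h1 h2 h3 hY h4 I hord hex ?_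
      intro y hy hs
      exact ⟨hnd y hy hs, fun hpw => hpow ⟨y, hy, hs, hpw⟩⟩

/-- The two classes at one marking give all data. [folklore] -/
theorem seqDimFour_one_of_gen_spec (hG : SeqNGen n) (hS : SeqNSpec n) : SeqDimFour 1 n :=
  seqDimFour_one_iff.mpr ⟨hG, hS⟩

/-- `SeqNGen n` is `SeqDimFour 1 n` restricted: weaker BY LETTER. [folklore] -/
theorem seqNGen_of_seqDimFour_one (h : SeqDimFour 1 n) : SeqNGen n := (seqDimFour_one_iff.mp h).1

/-- `SeqNSpec n` is `SeqDimFour 1 n` restricted: weaker BY LETTER. [folklore] -/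
theorem seqNSpec_of_seqDimFour_one (h : SeqDimFour 1 n) : SeqNSpec n := (seqDimFour_one_iff.mp h).2

/-- Each stratum is the located class restricted: weaker BY LETTER. [folklore] -/
theorem strata_of_seqNSpec (h : SeqNSpec n) : SeqNSpecDeep n ∧ SeqNSpecPower n ∧ SeqNSpecFin n :=
  seqNSpec_iff.mp h

/-- The three strata together give back the located class (recomposition). [folklore] -/
theorem seqNSpec_of_strata (hD : SeqNSpecDeep n) (hP : SeqNSpecPower n) (hF : SeqNSpecFin n) : SeqNSpec n :=
  seqNSpec_iff.mpr ⟨hD, hP, hF⟩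

/-- `SeqDimFour 2 n` is `SeqNGen n` restricted: `SeqDimFour 1 n ⇒ SeqNGen n ⇒ SeqDimFour 2 n`. [folklore] -/
theorem seqDimFour_two_of_seqNGen (h : SeqNGen n) : SeqDimFour 2 n := by
  intro p hp k _ _ Y g h1 h2 h3 hY h4 I hord hcls
  exact h p hp k Y g h1 h2 h3 hY h4 I hord (fun y hy => Or.inl (hcls y hy))

/-- **THE ENGINE AT WORK**: `VeryNearExit` turns every near-generic top point into a class-2-form EXIT point, and the
port `OneShotPortTwo n` does the bookkeeping: `NGenRungAt n` for `n ≥ 2`. [folklore] -/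
theorem nGenRungAt_of_engine (hE : VeryNearExit) (hP : OneShotPortTwo n) (hn : 2 ≤ n) : NGenRungAt n := by
  intro h2 p hp k _ _ Y g hg1 hg2 hg3 hY h4 I hord hcls
  refine hP h2 p hp k Y g hg1 hg2 hg3 hY h4 I hord ?_
  intro y hy
  rcases hcls y hy with h | ⟨hcl, hiso, d, c, hc, hfr, hface⟩
  · exact Or.inl h
  · exact Or.inr ⟨hcl, hiso, d, c, hc, hfr, hE Y I n hn y (hY y) d c hc hfr hface⟩

/-- At marking `1` every top point is a contact point, hence of class ≥ 2: `NGenRungAt 1` with no blow-up at all.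
[folklore] -/
theorem nGenRungAt_one (h1 : FaceFormCutClasses.OrderOneContact) : NGenRungAt 1 := by
  intro h2 p hp k _ _ Y g hg1 hg2 hg3 hY h4 I hord _
  refine h2 p hp k Y g hg1 hg2 hg3 hY h4 I hord ?_
  intro y hy
  exact Or.inr (Or.inl (h1 p hp k Y g hg1 hg2 hg3 hY I y hy))

/-- **`NearGenericRung` is DECIDED modulo the typed pieces**. [folklore] -/
theorem nearGenericRung_of_engine (hE : VeryNearExit) (hP : ∀ n : ℕ, 2 ≤ n → OneShotPortTwo n)
    (h1 : FaceFormCutClasses.OrderOneContact) : NearGenericRung := by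
  intro hE2 n hn
  by_cases h : 2 ≤ n
  · exact nGenRungAt_of_engine hE (hP n h) h (hE2 n hn)
  · have hn1 : n = 1 := by omega
    subst hn1
    exact nGenRungAt_one h1 (hE2 1 hn)

/-- `E 1` ⟺ the two families at every marking (EXACT, family level). [folklore] -/
theorem e_one_iff_families : E 1 ↔ (∀ n : ℕ, 1 ≤ n → SeqNGen n) ∧ (∀ n : ℕ, 1 ≤ n → SeqNSpec n) :=
  ⟨fun h => ⟨fun n hn => seqNGen_of_seqDimFour_one (h n hn), fun n hn => seqNSpec_of_seqDimFour_one (h n hn)⟩,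
    fun h n hn => seqDimFour_one_iff.mpr ⟨h.1 n hn, h.2 n hn⟩⟩

/-- The located residual split at the rung into its three strata (EXACT). [folklore] -/
theorem nearSpecialRung_iff_strata : NearSpecialRung ↔
    (E 2 → ∀ n : ℕ, 1 ≤ n → SeqNSpecDeep n) ∧ (E 2 → ∀ n : ℕ, 1 ≤ n → SeqNSpecPower n) ∧
      (E 2 → ∀ n : ℕ, 1 ≤ n → SeqNSpecFin n) :=
  ⟨fun h => ⟨fun hE2 n hn => (seqNSpec_iff.mp (h hE2 n hn)).1, fun hE2 n hn => (seqNSpec_iff.mp (h hE2 n hn)).2.1,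
      fun hE2 n hn => (seqNSpec_iff.mp (h hE2 n hn)).2.2⟩,
    fun h hE2 n hn => seqNSpec_iff.mpr ⟨h.1 hE2 n hn, h.2.1 hE2 n hn, h.2.2 hE2 n hn⟩⟩

end Kernels

/-! ## §6  Comparison with N50 `FaceFormCut` BY NAME (`Theorems.FaceFormCutClasses`): the g9 classes sit inside the
g10 ones (0 sorry) -/

section Refinement

/-- `MultLT` is monotone in the threshold. [folklore] -/
theorem multLT_mono {K : Type} [Field K] {d : ℕ} {P : MvPolynomial (Fin d) K} {v : Fin d → K} {m m' : ℕ}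
    (h : FaceFormCutClasses.MultLT P v m) (hle : m ≤ m') : FaceFormCutClasses.MultLT P v m' := by
  obtain ⟨α, hα, hlt⟩ := h
  exact ⟨α, hα, lt_of_lt_of_le hlt hle⟩

/-- `max(2, n−1) ≤ max(2, n)`. [folklore] -/
theorem faceThreshold_le_nearThreshold (n : ℕ) : FaceFormCutClasses.faceThreshold n ≤ nearThreshold n := by
  unfold FaceFormCutClasses.faceThreshold nearThreshold
  omega

/-- A g9-generic face is near-generic with the EMPTY list of directions. [folklore] -/
theorem hasNearGenericFace_of_hasGenericFace {R : Type} [CommRing R] [IsLocalRing R] {d : ℕ}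
    {c : Fin (d + 1) → R} {J : Ideal R} {n : ℕ} (h : FaceFormCutClasses.HasGenericFace c J n) : HasNearGenericFace c J n := by
  obtain ⟨G, hG, hf, hface⟩ := h
  refine ⟨G, hG, hf, 0, fun i => i.elim0, fun i => i.elim0, fun i => i.elim0, ?_, fun i => i.elim0⟩
  intro v hv hv0
  exact Or.inl (multLT_mono (hface v hv hv0) (faceThreshold_le_nearThreshold n))

/-- **g9's decided class ⊆ g10's decided class** (pointwise). [folklore] -/
theorem isNearGenericPt_of_isFaceGenericPt {Y : Scheme.{0}} {I : Y.IdealSheafData} {n : ℕ} {y : Y}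
    (h : FaceFormCutClasses.IsFaceGenericPt I n y) : IsNearGenericPt I n y := by
  obtain ⟨hcl, hiso, d, c, hc, hfr, hface⟩ := h
  exact ⟨hcl, hiso, d, c, hc, hfr, hasNearGenericFace_of_hasGenericFace hface⟩

/-- **g10's located class ⊆ g9's located class** (pointwise). [folklore] -/
theorem isFaceSpecialPt_of_isNearSpecialPt {k : Type} [Field k] {Y : Scheme.{0}} {g : Y ⟶ Spec (.of k)}
    {hY : Scheme.IsRegular Y} {I : Y.IdealSheafData} {n : ℕ} {y : Y} (h : IsNearSpecialPt g hY I n y) :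
    FaceFormCutClasses.IsFaceSpecialPt g hY I n y :=
  ⟨h.1, fun hg => h.2 (isNearGenericPt_of_isFaceGenericPt hg)⟩

/-- `SeqNGen n ⇒ SeqGen n` (the g10 decided piece is STRONGER than g9's). [folklore] -/
theorem seqGen_of_seqNGen {n : ℕ} (h : SeqNGen n) : FaceFormCutClasses.SeqGen n := by
  intro p hp k _ _ Y g h1 h2 h3 hY h4 I hord hcls
  refine h p hp k Y g h1 h2 h3 hY h4 I hord ?_
  intro y hy
  rcases hcls y hy with h' | h'
  · exact Or.inl h'
  · exact Or.inr (isNearGenericPt_of_isFaceGenericPt h')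

/-- `SeqSpec n ⇒ SeqNSpec n` (the g10 located residual is WEAKER BY LETTER than g9's). [folklore] -/
theorem seqNSpec_of_seqSpec {n : ℕ} (h : FaceFormCutClasses.SeqSpec n) : SeqNSpec n := by
  intro p hp k _ _ Y g h1 h2 h3 hY h4 I hord hex
  obtain ⟨y, hy, hs⟩ := hex
  exact h p hp k Y g h1 h2 h3 hY h4 I hord ⟨y, hy, isFaceSpecialPt_of_isNearSpecialPt hs⟩

end Refinement

end Summit.ResolutionOfSingularities.ResolutionOfSingularities.Theorems.VeryNearCutKernels
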